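import Mathlib
import Literature.Analysis.Calculus.BorderedImplicitFunction

/-!
# The bordering lemma and the bordered implicit function theorem at a SADDLE-NODE of a symmetric
# zero (two-dimensional kernel of the extended linearisation; Chow–Hale 1982 §2.4, Ch. 6;
# Vanderbauwhede 1982 Ch. 8; Kielhöfer 2012 §I.8, §I.12)

Analysis/Calculus proof file (Mathlib + `BorderedImplicitFunction`; theorems only, no definitions, no named facts).
The functional analysis behind "persistence, along a visible unfolding direction, of a periodic orbit at a
saddle-node of cycles".  The unknown is a pair `(x, μ) ∈ X × ℝ` (state and one extra scalar, e.g. the frequency), the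
linearisation of `N(x, μ) + frc(c) = 0` at `(x₀, μ₀)` is the EXTENDED operator `(h, m) ↦ T h + m • a`
(`T = D_xN`, `a = D_μN`); `T` is a compact perturbation of a linear homeomorphism with kernel `⊆ ℝ·g` (the symmetry
direction) and the saddle-node datum is `a = T h₁ ∈ range T` (a Jordan partner `h₁`), so that the extended operator has
the TWO-dimensional kernel `{(z g − w h₁, w)}` and the range of `T` (codimension one).  If a parameter direction `d` is
VISIBLE at first order (`frc d ∉ range T`) and two functionals `φ₁, φ₂` on `X × ℝ` separate the kernel plane, the doubly
bordered operator `(h, m, t) ↦ (T h + m a − t·frc d, φ₁(h,m), φ₂(h,m))` is bijective (`saddleNode_bordered_bijective`),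
and the ordinary implicit function theorem solves `N(x,μ) + frc(c' − t d) = 0`, `φᵢ((x,μ) − (x₀,μ₀)) = sᵢ` for
`((x,μ), t)` as continuous functions of `(c', s₁, s₂)` near `(c, 0, 0)`, uniquely near the base point
(`saddleNode_bordered_implicit_family`).  (Chow–Hale 1982, §2.4 "bordered operators", Ch. 6; Vanderbauwhede 1982,
Ch. 8; Kielhöfer 2012, §I.8 with the period as unknown, §I.12 Floquet exponent `0`.)

Not here: the dynamics (`N`), the group action producing `g`, the band/cone arguments consuming `σ` (summit side).

## References

* S.-N. Chow, J. K. Hale, *Methods of Bifurcation Theory*, Grundlehren 251, Springer (1982), §2.4, Ch. 6. [ChowHale1982]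
* A. Vanderbauwhede, *Local Bifurcation and Symmetry*, Pitman (1982), Ch. 8. [Vanderbauwhede1982]
* H. Kielhöfer, *Bifurcation Theory*, 2nd ed., Springer (2012), §I.8, §I.12. [Kielhofer2012]
-/

noncomputable section

open scoped Topology
open Filter Set Function

namespace Literature.Analysis.Calculus

section SaddleNode

variable {X Y : Type*} [NormedAddCommGroup X] [NormedSpace ℝ X] [CompleteSpace X]
  [NormedAddCommGroup Y] [NormedSpace ℝ Y]

/-- **The doubly bordered operator at a saddle-node is bijective** (real Banach spaces; Chow–Hale 1982 §2.4).
Let `T − J` be compact for a linear homeomorphism `J : X ≃ Y`, `ker T ⊆ ℝ·g`, `T h₁ = a`, `e ∉ range T`, and let the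
functionals `φ₁, φ₂ : X × ℝ → ℝ` separate the kernel plane `{(z g − w h₁, w)}` of the extended operator
`(h, m) ↦ T h + m a`.  Then `(h, m, t) ↦ (T h + m a − t e, φ₁(h,m), φ₂(h,m))` is bijective `X × ℝ × ℝ → Y × ℝ × ℝ`:
injective by visibility and separation; a compact perturbation of the isomorphism `(h,m,t) ↦ (J h, m, t)`, hence
bijective by the Fredholm alternative `bijective_of_injective_of_isCompactOperator`. [folklore] -/
theorem saddleNode_bordered_bijective (T : X →L[ℝ] Y) (J : X ≃L[ℝ] Y)
    (hK : IsCompactOperator (T - (J : X →L[ℝ] Y) : X →L[ℝ] Y)) (g h₁ : X) (a e : Y) (φ₁ φ₂ : X × ℝ →L[ℝ] ℝ)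
    (hker : ∀ x, T x = 0 → ∃ z : ℝ, x = z • g) (ha : T h₁ = a) (hrange : ∀ x, T x ≠ e)
    (hsep : ∀ z w : ℝ, φ₁ (z • g - w • h₁, w) = 0 → φ₂ (z • g - w • h₁, w) = 0 → z = 0 ∧ w = 0) :
    Bijective fun p : X × ℝ × ℝ => (T p.1 + p.2.1 • a - p.2.2 • e, φ₁ (p.1, p.2.1), φ₂ (p.1, p.2.1)) := by
  -- projections and the operator as a continuous linear map `M`
  set πh : X × ℝ × ℝ →L[ℝ] X := ContinuousLinearMap.fst ℝ X (ℝ × ℝ) with hπh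
  set πm : X × ℝ × ℝ →L[ℝ] ℝ := (ContinuousLinearMap.fst ℝ ℝ ℝ).comp (ContinuousLinearMap.snd ℝ X (ℝ × ℝ)) with hπm
  set πt : X × ℝ × ℝ →L[ℝ] ℝ := (ContinuousLinearMap.snd ℝ ℝ ℝ).comp (ContinuousLinearMap.snd ℝ X (ℝ × ℝ)) with hπt
  set πhm : X × ℝ × ℝ →L[ℝ] X × ℝ := πh.prod πm with hπhm
  set M : X × ℝ × ℝ →L[ℝ] Y × ℝ × ℝ :=
    (T.comp πh + πm.smulRight a - πt.smulRight e).prod ((φ₁.comp πhm).prod (φ₂.comp πhm)) with hM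
  have hMapply : ∀ p : X × ℝ × ℝ, M p = (T p.1 + p.2.1 • a - p.2.2 • e, φ₁ (p.1, p.2.1), φ₂ (p.1, p.2.1)) := by
    rintro ⟨h, m, t⟩; simp [hM, hπh, hπm, hπt, hπhm]
  have hfun : (fun p : X × ℝ × ℝ => (T p.1 + p.2.1 • a - p.2.2 • e, φ₁ (p.1, p.2.1), φ₂ (p.1, p.2.1))) = ⇑M :=
    funext fun p => (hMapply p).symm
  rw [hfun]
  -- injectivity: visibility kills `t`, then `(φ₁, φ₂)` separate the kernel plane
  have hinj : Injective M := by
    rw [injective_iff_map_eq_zero]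
    rintro ⟨h, m, t⟩ hp
    rw [hMapply] at hp
    simp only [Prod.mk_eq_zero] at hp
    obtain ⟨h1, h2, h3⟩ := hp
    have hT : T (h + m • h₁) = t • e := by
      rw [map_add, map_smul, ha]; exact sub_eq_zero.1 h1
    have ht : t = 0 := by
      by_contra ht
      refine hrange (t⁻¹ • (h + m • h₁)) ?_
      rw [map_smul, hT, smul_smul, inv_mul_cancel₀ ht, one_smul]
    rw [ht, zero_smul] at hT
    obtain ⟨z, hz⟩ := hker _ hT
    have hh : h = z • g - m • h₁ := by rw [← hz]; abel
    rw [hh] at h2 h3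
    obtain ⟨hz0, hm0⟩ := hsep z m h2 h3
    subst hz0; subst hm0; subst ht
    simp [hh]
  -- `M` is a compact perturbation of the isomorphism `J₃ (h,m,t) = (J h, m, t)`
  set J₃ : (X × ℝ × ℝ) ≃L[ℝ] (Y × ℝ × ℝ) := J.prodCongr (ContinuousLinearEquiv.refl ℝ (ℝ × ℝ)) with hJ₃
  set A : X × ℝ × ℝ →L[ℝ] Y := (T - (J : X →L[ℝ] Y)).comp πh + πm.smulRight a - πt.smulRight e with hA
  set Bℝ : X × ℝ × ℝ →L[ℝ] ℝ × ℝ := (φ₁.comp πhm - πm).prod (φ₂.comp πhm - πt) with hB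
  have hdecomp : ((M - (J₃ : X × ℝ × ℝ →L[ℝ] Y × ℝ × ℝ) : X × ℝ × ℝ →L[ℝ] Y × ℝ × ℝ) : X × ℝ × ℝ → Y × ℝ × ℝ) =
      ((ContinuousLinearMap.inl ℝ Y (ℝ × ℝ)) ∘ (A : X × ℝ × ℝ → Y)) +
        ((ContinuousLinearMap.inr ℝ Y (ℝ × ℝ)) ∘ (Bℝ : X × ℝ × ℝ → ℝ × ℝ)) := by
    funext p
    obtain ⟨h, m, t⟩ := p
    simp only [FunLike.coe_sub, Pi.sub_apply, hMapply, ContinuousLinearEquiv.coe_coe, hJ₃,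
      ContinuousLinearEquiv.prodCongr_apply, ContinuousLinearEquiv.refl_apply, Pi.add_apply, Function.comp_apply,
      ContinuousLinearMap.inl_apply, ContinuousLinearMap.inr_apply, hA, hB, hπh, hπm, hπt, hπhm]
    simp only [sub_apply, add_apply, ContinuousLinearMap.comp_apply,
      ContinuousLinearMap.coe_fst', ContinuousLinearMap.coe_snd', ContinuousLinearMap.smulRight_apply,
      ContinuousLinearMap.prod_apply, ContinuousLinearEquiv.coe_coe, Prod.mk_sub_mk, Prod.mk_add_mk, add_zero,
      zero_add]
    refine Prod.ext ?_ (Prod.ext ?_ ?_)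
    · simp; abel
    · simp
    · simp
  have hcomp : IsCompactOperator ((M - (J₃ : X × ℝ × ℝ →L[ℝ] Y × ℝ × ℝ) : X × ℝ × ℝ →L[ℝ] Y × ℝ × ℝ)) := by
    have hfr : ∀ (ψ : X × ℝ × ℝ →L[ℝ] ℝ) (y : Y), IsCompactOperator (ψ.smulRight y : X × ℝ × ℝ → Y) := by
      intro ψ y
      have hψc : IsCompactOperator (ψ : X × ℝ × ℝ → ℝ) := isCompactOperator_of_locallyCompactSpace_dom ψ
      have h := hψc.clm_comp (ContinuousLinearMap.toSpanSingleton ℝ y)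
      have hfe : ((ContinuousLinearMap.toSpanSingleton ℝ y) ∘ (ψ : X × ℝ × ℝ → ℝ) : X × ℝ × ℝ → Y) =
          (ψ.smulRight y : X × ℝ × ℝ → Y) := by
        funext x; simp [ContinuousLinearMap.toSpanSingleton_apply]
      rwa [hfe] at h
    have hAc : IsCompactOperator (A : X × ℝ × ℝ → Y) := by
      have h1 : IsCompactOperator ((T - (J : X →L[ℝ] Y)).comp πh : X × ℝ × ℝ → Y) := hK.comp_clm πh
      have h2 := (h1.add (hfr πm a)).sub (hfr πt e)
      have hfe : ((T - (J : X →L[ℝ] Y)).comp πh : X × ℝ × ℝ → Y) + (πm.smulRight a : X × ℝ × ℝ → Y) -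
          (πt.smulRight e : X × ℝ × ℝ → Y) = (A : X × ℝ × ℝ → Y) := by
        funext p; simp [hA]
      rwa [hfe] at h2
    have hBc : IsCompactOperator (Bℝ : X × ℝ × ℝ → ℝ × ℝ) := isCompactOperator_of_locallyCompactSpace_dom Bℝ
    have key := (hAc.clm_comp (ContinuousLinearMap.inl ℝ Y (ℝ × ℝ))).add
      (hBc.clm_comp (ContinuousLinearMap.inr ℝ Y (ℝ × ℝ)))
    rw [← hdecomp] at key
    exact key
  exact bijective_of_injective_of_isCompactOperator M J₃ hcomp hinj

section Implicit

variable [CompleteSpace Y] {P : Type*} [NormedAddCommGroup P] [NormedSpace ℝ P] [CompleteSpace P]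

/-- **The bordered implicit function theorem at a saddle-node, with two free kernel coordinates** (Chow–Hale 1982
Ch. 6; Vanderbauwhede 1982 §8.5; Kielhöfer 2012 §I.8).  Let `N : X × ℝ → Y` be `C¹` at `(x₀, μ₀)` with derivative
`(h, m) ↦ T h + m • a`, `frc : P → Y` continuous linear, `N (x₀, μ₀) + frc c = 0`, and let the doubly bordered operator
(with `e = frc d`) be bijective.  Then there are `σ : P × ℝ × ℝ → ℝ` and `υ : P × ℝ × ℝ → X × ℝ`, continuous on a ball
around `(c, 0, 0)`, with `σ (c,0,0) = 0`, `υ (c,0,0) = (x₀, μ₀)`, solving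
`N (υ q) + frc (q.1 − σ q • d) = 0`, `φ₁ (υ q − (x₀,μ₀)) = q.2.1`, `φ₂ (υ q − (x₀,μ₀)) = q.2.2` on the ball, and these
are the ONLY solutions near the base point. [folklore] -/
theorem saddleNode_bordered_implicit_family (N : X × ℝ → Y) (frc : P →L[ℝ] Y) (T : X →L[ℝ] Y) (a : Y)
    (φ₁ φ₂ : X × ℝ →L[ℝ] ℝ) (x₀ : X) (μ₀ : ℝ) (c d : P) (hN : ContDiffAt ℝ 1 N (x₀, μ₀))
    (hT : HasFDerivAt N (T.comp (ContinuousLinearMap.fst ℝ X ℝ) + (ContinuousLinearMap.snd ℝ X ℝ).smulRight a) (x₀, μ₀))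
    (h0 : N (x₀, μ₀) + frc c = 0)
    (hD : Bijective fun p : X × ℝ × ℝ => (T p.1 + p.2.1 • a - p.2.2 • frc d, φ₁ (p.1, p.2.1), φ₂ (p.1, p.2.1))) :
    ∃ (σ : P × ℝ × ℝ → ℝ) (υ : P × ℝ × ℝ → X × ℝ) (r : ℝ), 0 < r ∧ σ (c, 0, 0) = 0 ∧ υ (c, 0, 0) = (x₀, μ₀) ∧
      ContinuousOn σ (Metric.ball (c, (0 : ℝ), (0 : ℝ)) r) ∧ ContinuousOn υ (Metric.ball (c, (0 : ℝ), (0 : ℝ)) r) ∧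
      (∀ q ∈ Metric.ball (c, (0 : ℝ), (0 : ℝ)) r, N (υ q) + frc (q.1 - σ q • d) = 0 ∧
        φ₁ (υ q - (x₀, μ₀)) = q.2.1 ∧ φ₂ (υ q - (x₀, μ₀)) = q.2.2) ∧
      ∀ q ∈ Metric.ball (c, (0 : ℝ), (0 : ℝ)) r, ∀ (w : X × ℝ) (t : ℝ), dist w (x₀, μ₀) < r → |t| < r →
        N w + frc (q.1 - t • d) = 0 → φ₁ (w - (x₀, μ₀)) = q.2.1 → φ₂ (w - (x₀, μ₀)) = q.2.2 → w = υ q ∧ t = σ q := by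
  -- the bordered map `Φ((c', s₁, s₂), (w, t)) = (N w + frc (c' − t d), φ₁ (w − w₀) − s₁, φ₂ (w − w₀) − s₂)`
  set w₀ : X × ℝ := (x₀, μ₀) with hw₀
  set Φ : (P × ℝ × ℝ) × ((X × ℝ) × ℝ) → Y × ℝ × ℝ := fun v =>
    (N v.2.1 + frc (v.1.1 - v.2.2 • d), φ₁ (v.2.1 - w₀) - v.1.2.1, φ₂ (v.2.1 - w₀) - v.1.2.2) with hΦ
  set pt : (P × ℝ × ℝ) × ((X × ℝ) × ℝ) := ((c, 0, 0), (w₀, 0)) with hpt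
  have hΦpt : Φ pt = 0 := by simp [hΦ, hpt, h0]
  -- projections
  set πw : (P × ℝ × ℝ) × ((X × ℝ) × ℝ) →L[ℝ] X × ℝ :=
    (ContinuousLinearMap.fst ℝ (X × ℝ) ℝ).comp (ContinuousLinearMap.snd ℝ (P × ℝ × ℝ) ((X × ℝ) × ℝ)) with hπw
  set πt : (P × ℝ × ℝ) × ((X × ℝ) × ℝ) →L[ℝ] ℝ :=
    (ContinuousLinearMap.snd ℝ (X × ℝ) ℝ).comp (ContinuousLinearMap.snd ℝ (P × ℝ × ℝ) ((X × ℝ) × ℝ)) with hπt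
  set πc : (P × ℝ × ℝ) × ((X × ℝ) × ℝ) →L[ℝ] P :=
    (ContinuousLinearMap.fst ℝ P (ℝ × ℝ)).comp (ContinuousLinearMap.fst ℝ (P × ℝ × ℝ) ((X × ℝ) × ℝ)) with hπc
  set πs₁ : (P × ℝ × ℝ) × ((X × ℝ) × ℝ) →L[ℝ] ℝ :=
    ((ContinuousLinearMap.fst ℝ ℝ ℝ).comp (ContinuousLinearMap.snd ℝ P (ℝ × ℝ))).comp
      (ContinuousLinearMap.fst ℝ (P × ℝ × ℝ) ((X × ℝ) × ℝ)) with hπs₁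
  set πs₂ : (P × ℝ × ℝ) × ((X × ℝ) × ℝ) →L[ℝ] ℝ :=
    ((ContinuousLinearMap.snd ℝ ℝ ℝ).comp (ContinuousLinearMap.snd ℝ P (ℝ × ℝ))).comp
      (ContinuousLinearMap.fst ℝ (P × ℝ × ℝ) ((X × ℝ) × ℝ)) with hπs₂
  set DN : X × ℝ →L[ℝ] Y := T.comp (ContinuousLinearMap.fst ℝ X ℝ) + (ContinuousLinearMap.snd ℝ X ℝ).smulRight a
    with hDN
  set Φ' : (P × ℝ × ℝ) × ((X × ℝ) × ℝ) →L[ℝ] Y × ℝ × ℝ :=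
    (DN.comp πw + frc.comp (πc - πt.smulRight d)).prod ((φ₁.comp πw - πs₁).prod (φ₂.comp πw - πs₂)) with hΦ'
  have hπwpt : πw pt = w₀ := rfl
  -- derivative and regularity of `Φ` at `pt`
  have hΦd : HasFDerivAt Φ Φ' pt := by
    have h1 : HasFDerivAt (fun v : (P × ℝ × ℝ) × ((X × ℝ) × ℝ) => N v.2.1) (DN.comp πw) pt := by
      have hT' : HasFDerivAt N DN (πw pt) := by rw [hπwpt]; exact hT
      exact hT'.comp pt πw.hasFDerivAt
    have h2 : HasFDerivAt (fun v : (P × ℝ × ℝ) × ((X × ℝ) × ℝ) => frc (v.1.1 - v.2.2 • d))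
        (frc.comp (πc - πt.smulRight d)) pt := by
      have e2 : (fun v : (P × ℝ × ℝ) × ((X × ℝ) × ℝ) => frc (v.1.1 - v.2.2 • d)) =
          ⇑(frc.comp (πc - πt.smulRight d)) := by
        funext v; simp [hπc, hπt]
      rw [e2]; exact (frc.comp (πc - πt.smulRight d)).hasFDerivAt
    have h3 : HasFDerivAt (fun v : (P × ℝ × ℝ) × ((X × ℝ) × ℝ) => φ₁ (v.2.1 - w₀) - v.1.2.1) (φ₁.comp πw - πs₁) pt := by
      have e3 : (fun v : (P × ℝ × ℝ) × ((X × ℝ) × ℝ) => φ₁ (v.2.1 - w₀) - v.1.2.1) =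
          fun v => (φ₁.comp πw - πs₁) v - φ₁ w₀ := by
        funext v; simp [hπw, hπs₁, map_sub]; abel
      rw [e3]; exact (φ₁.comp πw - πs₁).hasFDerivAt.sub_const (φ₁ w₀)
    have h4 : HasFDerivAt (fun v : (P × ℝ × ℝ) × ((X × ℝ) × ℝ) => φ₂ (v.2.1 - w₀) - v.1.2.2) (φ₂.comp πw - πs₂) pt := by
      have e4 : (fun v : (P × ℝ × ℝ) × ((X × ℝ) × ℝ) => φ₂ (v.2.1 - w₀) - v.1.2.2) =
          fun v => (φ₂.comp πw - πs₂) v - φ₂ w₀ := by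
        funext v; simp [hπw, hπs₂, map_sub]; abel
      rw [e4]; exact (φ₂.comp πw - πs₂).hasFDerivAt.sub_const (φ₂ w₀)
    exact (h1.add h2).prodMk (h3.prodMk h4)
  have hΦc : ContDiffAt ℝ 1 Φ pt := by
    have h1 : ContDiffAt ℝ 1 (fun v : (P × ℝ × ℝ) × ((X × ℝ) × ℝ) => N v.2.1) pt := by
      have hN' : ContDiffAt ℝ 1 N (πw pt) := by rw [hπwpt]; exact hN
      exact hN'.comp pt πw.contDiff.contDiffAt
    have h2 : ContDiffAt ℝ 1 (fun v : (P × ℝ × ℝ) × ((X × ℝ) × ℝ) => frc (v.1.1 - v.2.2 • d)) pt := by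
      have e2 : (fun v : (P × ℝ × ℝ) × ((X × ℝ) × ℝ) => frc (v.1.1 - v.2.2 • d)) =
          ⇑(frc.comp (πc - πt.smulRight d)) := by
        funext v; simp [hπc, hπt]
      rw [e2]; exact (frc.comp (πc - πt.smulRight d)).contDiff.contDiffAt
    have h3 : ContDiffAt ℝ 1 (fun v : (P × ℝ × ℝ) × ((X × ℝ) × ℝ) => φ₁ (v.2.1 - w₀) - v.1.2.1) pt := by
      have e3 : (fun v : (P × ℝ × ℝ) × ((X × ℝ) × ℝ) => φ₁ (v.2.1 - w₀) - v.1.2.1) =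
          fun v => (φ₁.comp πw - πs₁) v - φ₁ w₀ := by
        funext v; simp [hπw, hπs₁, map_sub]; abel
      rw [e3]; exact (φ₁.comp πw - πs₁).contDiff.contDiffAt.sub contDiffAt_const
    have h4 : ContDiffAt ℝ 1 (fun v : (P × ℝ × ℝ) × ((X × ℝ) × ℝ) => φ₂ (v.2.1 - w₀) - v.1.2.2) pt := by
      have e4 : (fun v : (P × ℝ × ℝ) × ((X × ℝ) × ℝ) => φ₂ (v.2.1 - w₀) - v.1.2.2) =
          fun v => (φ₂.comp πw - πs₂) v - φ₂ w₀ := by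
        funext v; simp [hπw, hπs₂, map_sub]; abel
      rw [e4]; exact (φ₂.comp πw - πs₂).contDiff.contDiffAt.sub contDiffAt_const
    exact (h1.add h2).prodMk (h3.prodMk h4)
  -- the partial derivative in `(w, t)` is the doubly bordered operator (re-associated), which is invertible
  have hinr : ⇑(Φ' ∘L ContinuousLinearMap.inr ℝ (P × ℝ × ℝ) ((X × ℝ) × ℝ)) =
      fun u : (X × ℝ) × ℝ => (T u.1.1 + u.1.2 • a - u.2 • frc d, φ₁ u.1, φ₂ u.1) := by
    funext u
    obtain ⟨⟨h, m⟩, t⟩ := u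
    simp [hΦ', hDN, hπw, hπt, hπc, hπs₁, hπs₂, sub_eq_add_neg]
  have hbij : Bijective (Φ' ∘L ContinuousLinearMap.inr ℝ (P × ℝ × ℝ) ((X × ℝ) × ℝ)) := by
    rw [hinr]
    set α : (X × ℝ) × ℝ ≃ X × ℝ × ℝ := Equiv.prodAssoc X ℝ ℝ with hα
    have hcompose : (fun u : (X × ℝ) × ℝ => (T u.1.1 + u.1.2 • a - u.2 • frc d, φ₁ u.1, φ₂ u.1)) =
        (fun p : X × ℝ × ℝ => (T p.1 + p.2.1 • a - p.2.2 • frc d, φ₁ (p.1, p.2.1), φ₂ (p.1, p.2.1))) ∘ α := by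
      funext u
      obtain ⟨⟨h, m⟩, t⟩ := u
      simp [hα, Equiv.prodAssoc_apply]
    rw [hcompose]
    exact hD.comp α.bijective
  have if₂ : (fderiv ℝ Φ pt ∘L ContinuousLinearMap.inr ℝ (P × ℝ × ℝ) ((X × ℝ) × ℝ)).IsInvertible := by
    rw [hΦd.fderiv]
    exact ⟨ContinuousLinearEquiv.ofBijective _ (LinearMap.ker_eq_bot.2 hbij.1) (LinearMap.range_eq_top.2 hbij.2),
      ContinuousLinearEquiv.coe_ofBijective _ _ _⟩
  -- the implicit function `ψ = (υ, σ)`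
  set ψ : P × ℝ × ℝ → (X × ℝ) × ℝ := hΦc.implicitFunction one_ne_zero if₂ with hψ
  have hψc : ψ (c, 0, 0) = (w₀, 0) := hΦc.implicitFunction_apply_self one_ne_zero if₂
  have hev : ∀ᶠ q in 𝓝 (c, (0 : ℝ), (0 : ℝ)), Φ (q, ψ q) = Φ pt :=
    hΦc.eventually_apply_implicitFunction one_ne_zero if₂
  have huniq : ∀ᶠ v in 𝓝 pt, Φ v = Φ pt ↔ ψ v.1 = v.2 :=
    hΦc.eventually_apply_eq_iff_implicitFunction one_ne_zero if₂
  have hψd : ContDiffAt ℝ 1 ψ (c, 0, 0) := hΦc.contDiffAt_implicitFunction one_ne_zero if₂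
  set σ : P × ℝ × ℝ → ℝ := fun q => (ψ q).2 with hσ
  set υ : P × ℝ × ℝ → X × ℝ := fun q => (ψ q).1 with hυ
  -- radii: solutions + continuity on a ball, uniqueness on a ball
  have hψcont : ∀ᶠ q in 𝓝 (c, (0 : ℝ), (0 : ℝ)), ContDiffAt ℝ 1 ψ q := hψd.eventually (by simp)
  obtain ⟨r₁, hr₁, hball₁⟩ := Metric.eventually_nhds_iff.1 (hev.and hψcont)
  obtain ⟨r₂, hr₂, hball₂⟩ := Metric.eventually_nhds_iff.1 huniq
  refine ⟨σ, υ, min r₁ r₂, lt_min hr₁ hr₂, by simp [hσ, hψc], by simp [hυ, hψc], ?_, ?_, ?_, ?_⟩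
  · intro q hq
    have hq₁ : dist q (c, 0, 0) < r₁ := lt_of_lt_of_le (Metric.mem_ball.1 hq) (min_le_left _ _)
    exact ((hball₁ hq₁).2.continuousAt.snd).continuousWithinAt
  · intro q hq
    have hq₁ : dist q (c, 0, 0) < r₁ := lt_of_lt_of_le (Metric.mem_ball.1 hq) (min_le_left _ _)
    exact ((hball₁ hq₁).2.continuousAt.fst).continuousWithinAt
  · intro q hq
    have hq₁ : dist q (c, 0, 0) < r₁ := lt_of_lt_of_le (Metric.mem_ball.1 hq) (min_le_left _ _)
    have h := (hball₁ hq₁).1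
    rw [hΦpt] at h
    simp only [hΦ, Prod.mk_eq_zero, sub_eq_zero] at h
    exact ⟨h.1, h.2.1, h.2.2⟩
  · intro q hq w t hw ht hsol hφ₁ hφ₂
    have hq₂ : dist q (c, 0, 0) < r₂ := lt_of_lt_of_le (Metric.mem_ball.1 hq) (min_le_right _ _)
    have hv : dist ((q, (w, t)) : (P × ℝ × ℝ) × ((X × ℝ) × ℝ)) pt < r₂ := by
      have e1 : dist ((q, (w, t)) : (P × ℝ × ℝ) × ((X × ℝ) × ℝ)) pt =
          max (dist q (c, 0, 0)) (dist ((w, t) : (X × ℝ) × ℝ) (w₀, 0)) := by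
        rw [hpt]; exact Prod.dist_eq
      have e2 : dist ((w, t) : (X × ℝ) × ℝ) (w₀, 0) = max (dist w w₀) (dist t 0) := Prod.dist_eq
      rw [e1, e2, Real.dist_eq, sub_zero]
      refine max_lt hq₂ (max_lt ?_ (lt_of_lt_of_le ht (min_le_right _ _)))
      exact lt_of_lt_of_le hw (min_le_right _ _)
    have hΦv : Φ (q, (w, t)) = Φ pt := by
      rw [hΦpt]
      simp only [hΦ, Prod.mk_eq_zero]
      exact ⟨hsol, by rw [hφ₁]; simp, by rw [hφ₂]; simp⟩
    have h := (hball₂ hv).1 hΦv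
    -- `ψ q = (w, t)`
    refine ⟨?_, ?_⟩
    · show w = (ψ q).1
      rw [h]
    · show t = (ψ q).2
      rw [h]

end Implicit

end SaddleNode

end Literature.Analysis.Calculus

end
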